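import Mathlib
import Summits.Ventures.PercRepro2.SeriesCollapse

/-!
# The series reduction of the mean-field functional (blind cell PercRepro2, night-1 g15;
NIGHT1-G15.md §2 — the continuation of `SeriesCollapse`)

With the collapse of `SeriesCollapse` (an unmarked vertex `v` of degree two, edges `f = {v, w}` and
`f' = {v, w'}`): the residual terms of `X̂` are collapse-invariant (`termW_collapse`), `v` joins a
removed set containing one of its neighbours without changing the residual term (`termW_insert_pair`),
the residual term of the cluster of `a₃` is collapse-invariant pointwise (`termW_cluster_collapse`),
hence `X̂` (`Xhat_series`) and every mass of `HMFc` see the two weights only through their product: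
**`HMFc p = HMFc p[f ↦ p f · p f', f' ↦ 1]`** (`HMFc_series`, `HMF_series_iff`); the same for the cleared
(HCOV) functional (`Gc_series`, `HCov_series_iff`).  This completes the series reduction whose
probability half is `SeriesPin` / `SeriesConn` (night-1 g14).
-/

open scoped Classical

namespace Summit.Ventures.PercRepro2

open UnionCluster CovForm PendantRoot

namespace SeriesCollapse

section MeanField

variable {V : Type*} {E : Type*} [Fintype E] [DecidableEq E] [Fintype V] [DecidableEq V]
  {R : Type*} [Field R] {ends : E → Sym2 V} {v w w' : V} {f f' : E}

/-- **The residual terms of `X̂` are collapse-invariant**: `termW` at the collapsed weights equals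
`termW` at the original weights, for every removed set `W`. -/
theorem termW_collapse (p : E → R) (hff : f ≠ f') (hf : ends f = s(v, w)) (hf' : ends f' = s(v, w'))
    (hdeg : ∀ e, v ∈ ends e → e = f ∨ e = f') (hvw : v ≠ w) (hvw' : v ≠ w') {o a₁ a₂ b : V}
    (ho : o ≠ v) (h1 : a₁ ≠ v) (h2 : a₂ ≠ v) (hb : b ≠ v) (W : Finset V) :
    termW (Function.update (Function.update p f (p f * p f')) f' 1) ends o a₁ a₂ b W =
      termW p ends o a₁ a₂ b W := by
  have hc : ∀ x y : V, x ≠ v → y ≠ v →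
      collapse f f' ⁻¹' connDelEvent ends W x y = connDelEvent ends W x y :=
    fun x y hx hy => preimage_connDelEvent_collapse hff hf hf' hdeg hvw hvw' W hx hy
  have hQ := preimage_delQ_collapse hff hf hf' hdeg hvw hvw' W h1 h2
  simp only [termW, termT, termPD, delConnProb, delShareMass, prob_collapse p hff,
    Set.preimage_inter, hQ, hc _ _ h1 ho, hc _ _ h2 ho, hc _ _ h1 hb, hc _ _ h2 hb]

/-- **`v` joins a removed set containing one of its neighbours without changing the residual term.** -/
theorem termW_insert_pair (p : E → R) (hf : ends f = s(v, w)) (hf' : ends f' = s(v, w'))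
    (hdeg : ∀ e, v ∈ ends e → e = f ∨ e = f') (hvw : v ≠ w) (hvw' : v ≠ w') {W : Finset V}
    (hW : w ∈ W ∨ w' ∈ W) {o a₁ a₂ b : V} (ho : o ≠ v) (h1 : a₁ ≠ v) (h2 : a₂ ≠ v) (hb : b ≠ v) :
    termW p ends o a₁ a₂ b (insert v W) = termW p ends o a₁ a₂ b W := by
  have m1 : a₁ ∈ insert v W ↔ a₁ ∈ W := by simp [Finset.mem_insert, h1]
  have m2 : a₂ ∈ insert v W ↔ a₂ ∈ W := by simp [Finset.mem_insert, h2]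
  have mo : o ∈ insert v W ↔ o ∈ W := by simp [Finset.mem_insert, ho]
  have mb : b ∈ insert v W ↔ b ∈ W := by simp [Finset.mem_insert, hb]
  have hc : ∀ x y : V, x ≠ v → y ≠ v →
      connDelEvent ends (insert v W) x y = connDelEvent ends W x y :=
    fun x y hx hy => connDelEvent_insert_pair hf hf' hdeg hvw hvw' hW hx hy
  have hQ := delQ_insert_pair hf hf' hdeg hvw hvw' hW h1 h2
  simp only [termW, termT, termPD, delConnProb, delShareMass, m1, m2, mo, mb, hQ, hc _ _ h1 ho,
    hc _ _ h2 ho, hc _ _ h1 hb, hc _ _ h2 hb]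

/-- **Pointwise**: the residual term of the cluster of `a₃` is collapse-invariant.  The collapse
changes the cluster at most at `v`, and `v` can only enter or leave a cluster that contains one of
its neighbours, where it is invisible to the residual term. -/
theorem termW_cluster_collapse (p : E → R) (hff : f ≠ f') (hf : ends f = s(v, w))
    (hf' : ends f' = s(v, w')) (hdeg : ∀ e, v ∈ ends e → e = f ∨ e = f') (hvw : v ≠ w)
    (hvw' : v ≠ w') {o a₁ a₂ a₃ b : V} (ho : o ≠ v) (h1 : a₁ ≠ v) (h2 : a₂ ≠ v) (h3 : a₃ ≠ v)
    (hb : b ≠ v) (ω : Config E) :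
    termW p ends o a₁ a₂ b (cluster ends (collapse f f' ω) a₃).toFinset =
      termW p ends o a₁ a₂ b (cluster ends ω a₃).toFinset := by
  set C : Finset V := (cluster ends ω a₃).toFinset with hC
  set C' : Finset V := (cluster ends (collapse f f' ω) a₃).toFinset with hC'
  have hmem : ∀ u, u ≠ v → (u ∈ C' ↔ u ∈ C) := by
    intro u hu
    rw [hC, hC', Set.mem_toFinset, Set.mem_toFinset]
    exact mem_cluster_collapse_of_ne hff hf hf' hdeg hvw hvw' ω h3 hu
  have hv' : v ∈ C' ↔ w' ∈ C := by
    rw [hC, hC', Set.mem_toFinset, Set.mem_toFinset]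
    exact mem_cluster_collapse_v hff hf hf' hdeg hvw hvw' ω h3
  have herase : C'.erase v = C.erase v := by
    ext u
    simp only [Finset.mem_erase]
    constructor
    · rintro ⟨hu, huC'⟩
      exact ⟨hu, (hmem u hu).1 huC'⟩
    · rintro ⟨hu, huC⟩
      exact ⟨hu, (hmem u hu).2 huC⟩
  have hW : v ∈ C ∨ v ∈ C' → (w ∈ C.erase v ∨ w' ∈ C.erase v) := by
    rintro (hvC | hvC')
    · have hconn : Conn ends ω a₃ v := by rw [hC, Set.mem_toFinset] at hvC; exact hvC
      rcases conn_to_pair hf hf' hdeg hvw hvw' h3 hconn with ⟨_, hw⟩ | ⟨_, hw'⟩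
      · exact Or.inl (Finset.mem_erase.2 ⟨hvw.symm, by rw [hC, Set.mem_toFinset]; exact hw⟩)
      · exact Or.inr (Finset.mem_erase.2 ⟨hvw'.symm, by rw [hC, Set.mem_toFinset]; exact hw'⟩)
    · exact Or.inr (Finset.mem_erase.2 ⟨hvw'.symm, hv'.1 hvC'⟩)
  have key : ∀ D : Finset V, D.erase v = C.erase v →
      (v ∈ D → w ∈ C.erase v ∨ w' ∈ C.erase v) →
      termW p ends o a₁ a₂ b D = termW p ends o a₁ a₂ b (C.erase v) := by
    intro D hD hDv
    by_cases hvD : v ∈ D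
    · have hDeq : D = insert v (C.erase v) := by rw [← hD, Finset.insert_erase hvD]
      exact (congrArg (termW p ends o a₁ a₂ b) hDeq).trans
        (termW_insert_pair p hf hf' hdeg hvw hvw' (hDv hvD) ho h1 h2 hb)
    · exact congrArg (termW p ends o a₁ a₂ b) ((Finset.erase_eq_of_notMem hvD).symm.trans hD)
  rw [key C' herase (fun h => hW (Or.inr h)), key C rfl (fun h => hW (Or.inl h))]

/-- **The mean field `X̂` sees two edges in series only through the product of their weights.** -/
theorem Xhat_series (p : E → R) (hff : f ≠ f') (hf : ends f = s(v, w)) (hf' : ends f' = s(v, w'))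
    (hdeg : ∀ e, v ∈ ends e → e = f ∨ e = f') (hvw : v ≠ w) (hvw' : v ≠ w') {o a₁ a₂ a₃ b : V}
    (ho : o ≠ v) (h1 : a₁ ≠ v) (h2 : a₂ ≠ v) (h3 : a₃ ≠ v) (hb : b ≠ v) :
    Xhat (Function.update (Function.update p f (p f * p f')) f' 1) ends o a₁ a₂ a₃ b =
      Xhat p ends o a₁ a₂ a₃ b := by
  rw [HMFLeafInvisible.Xhat_eq_expect, HMFLeafInvisible.Xhat_eq_expect, expect_collapse p hff]
  congr 1
  funext ω
  show termW (Function.update (Function.update p f (p f * p f')) f' 1) ends o a₁ a₂ b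
      (cluster ends (collapse f f' ω) a₃).toFinset = termW p ends o a₁ a₂ b (cluster ends ω a₃).toFinset
  rw [termW_collapse p hff hf hf' hdeg hvw hvw' ho h1 h2 hb,
    termW_cluster_collapse p hff hf hf' hdeg hvw hvw' ho h1 h2 h3 hb ω]

/-- **THE SERIES REDUCTION OF THE MEAN-FIELD FUNCTIONAL**: at an unmarked vertex `v` of degree two
with edges `f = {v, w}`, `f' = {v, w'}`, `HMFc p = HMFc p[f ↦ p f · p f', f' ↦ 1]`. -/
theorem HMFc_series (p : E → R) (hff : f ≠ f') (hf : ends f = s(v, w)) (hf' : ends f' = s(v, w'))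
    (hdeg : ∀ e, v ∈ ends e → e = f ∨ e = f') (hvw : v ≠ w) (hvw' : v ≠ w') {o a₁ a₂ a₃ b : V}
    (ho : o ≠ v) (h1 : a₁ ≠ v) (h2 : a₂ ≠ v) (h3 : a₃ ≠ v) (hb : b ≠ v) :
    HMFc (Function.update (Function.update p f (p f * p f')) f' 1) ends o a₁ a₂ a₃ b =
      HMFc p ends o a₁ a₂ a₃ b := by
  have hc : ∀ x y : V, x ≠ v → y ≠ v → collapse f f' ⁻¹' connEvent ends x y = connEvent ends x y :=
    fun x y hx hy => preimage_connEvent_collapse hff hf hf' hdeg hvw hvw' hx hy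
  have hQ := preimage_avoidAll_collapse hff hf hf' hdeg hvw hvw' h1 h2
  have hPD := preimage_PDEvent_collapse hff hf hf' hdeg hvw hvw' h1 h2 h3
  have hT := preimage_TEvent_collapse hff hf hf' hdeg hvw hvw' h1 h2 h3
  have hT' := preimage_TEvent_collapse hff hf hf' hdeg hvw hvw' h2 h1 h3
  simp only [HMFc, marginC, DEF, Do, EQo, EQ3, EQ3o, massM2, deltaT, gap]
  rw [Xhat_series p hff hf hf' hdeg hvw hvw' ho h1 h2 h3 hb]
  simp only [prob_collapse p hff, Set.preimage_inter, hQ, hPD, hT, hT', hc _ _ h1 ho, hc _ _ h2 ho,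
    hc _ _ h1 hb, hc _ _ h2 hb]

/-- **(HMF) sees two edges in series only through the product of their weights.** -/
theorem HMF_series_iff [LinearOrder R] (p : E → R) (hff : f ≠ f') (hf : ends f = s(v, w))
    (hf' : ends f' = s(v, w')) (hdeg : ∀ e, v ∈ ends e → e = f ∨ e = f') (hvw : v ≠ w)
    (hvw' : v ≠ w') {o a₁ a₂ a₃ b : V} (ho : o ≠ v) (h1 : a₁ ≠ v) (h2 : a₂ ≠ v) (h3 : a₃ ≠ v)
    (hb : b ≠ v) :
    HMF (Function.update (Function.update p f (p f * p f')) f' 1) ends o a₁ a₂ a₃ b ↔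
      HMF p ends o a₁ a₂ a₃ b := by
  unfold HMF
  rw [HMFc_series p hff hf hf' hdeg hvw hvw' ho h1 h2 h3 hb]

omit [Fintype V] [DecidableEq V] in
/-- **The cleared (HCOV) functional `Gc` sees two edges in series only through the product of
their weights** (every mass of `Gc` is the probability of a marked event). -/
theorem Gc_series [LinearOrder R] (p : E → R) (hff : f ≠ f') (hf : ends f = s(v, w))
    (hf' : ends f' = s(v, w')) (hdeg : ∀ e, v ∈ ends e → e = f ∨ e = f') (hvw : v ≠ w)
    (hvw' : v ≠ w') {o a₁ a₂ a₃ b : V} (ho : o ≠ v) (h1 : a₁ ≠ v) (h2 : a₂ ≠ v) (h3 : a₃ ≠ v)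
    (hb : b ≠ v) :
    Gc (Function.update (Function.update p f (p f * p f')) f' 1) ends o a₁ a₂ a₃ b =
      Gc p ends o a₁ a₂ a₃ b := by
  have hc : ∀ x y : V, x ≠ v → y ≠ v → collapse f f' ⁻¹' connEvent ends x y = connEvent ends x y :=
    fun x y hx hy => preimage_connEvent_collapse hff hf hf' hdeg hvw hvw' hx hy
  have hQ := preimage_avoidAll_collapse hff hf hf' hdeg hvw hvw' h1 h2
  have hPD := preimage_PDEvent_collapse hff hf hf' hdeg hvw hvw' h1 h2 h3
  have hT := preimage_TEvent_collapse hff hf hf' hdeg hvw hvw' h1 h2 h3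
  have hT' := preimage_TEvent_collapse hff hf hf' hdeg hvw hvw' h2 h1 h3
  simp only [Gc, EQbo, EQb3, EQb3o, Do, gap, DEF, EQo, EQ3, EQ3o, PDb, PDbo]
  simp only [prob_collapse p hff, Set.preimage_inter, hQ, hPD, hT, hT', hc _ _ h1 ho, hc _ _ h2 ho,
    hc _ _ h1 hb, hc _ _ h2 hb]

omit [Fintype V] [DecidableEq V] in
/-- **(HCOV) sees two edges in series only through the product of their weights.** -/
theorem HCov_series_iff [LinearOrder R] (p : E → R) (hff : f ≠ f') (hf : ends f = s(v, w))
    (hf' : ends f' = s(v, w')) (hdeg : ∀ e, v ∈ ends e → e = f ∨ e = f') (hvw : v ≠ w)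
    (hvw' : v ≠ w') {o a₁ a₂ a₃ b : V} (ho : o ≠ v) (h1 : a₁ ≠ v) (h2 : a₂ ≠ v) (h3 : a₃ ≠ v)
    (hb : b ≠ v) :
    HCov (Function.update (Function.update p f (p f * p f')) f' 1) ends o a₁ a₂ a₃ b ↔
      HCov p ends o a₁ a₂ a₃ b := by
  unfold HCov
  rw [Gc_series p hff hf hf' hdeg hvw hvw' ho h1 h2 h3 hb]

end MeanField

end SeriesCollapse

end Summit.Ventures.PercRepro2
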